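import Literature.MathematicalPhysics.QuantumFieldTheory.Balaban1983to89.B1Sect1Statements

/-!
# Bałaban, *(Higgs)₂,₃ quantum fields in a finite volume I*, CMP **85** (1982): the SECOND printed forms of the
# definition displays (1.6) (plaquette derivative = lattice curl) and (1.21) (volume = sum of `η^d`), proved for the
# typer's carrier definitions `HiggsLattice.curl` and `HiggsLattice.Params.vol`

statement-level skeleton of published theorems with citation tags; proofs where landed; nothing here is a claim about the Yang–Mills mass gap

CITATION HEADER.  T. Bałaban, *(Higgs)₂,₃ quantum fields in a finite volume. I. A lower bound*, Commun. Math. Phys. **85**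
(1982) 603–626 [Balaban1982Higgs1] (cell paper B1; PDF held `paper:balaban1982-cmp85-higgs23-i`, journal page = PDF page +
602; pp. 604 and 607 read AS IMAGES on the ×2 renders `run/shared/lean/pub/pub-balaban/b2b-balaban-ref1/pages/
1982-cmp85-higgs23-I/1982-cmp85-higgs23-I-p002-x2.png`, `…-p005-x2.png`).  Unit `lit-balaban-r14` gen 23
(literature-prover-lit-balaban-r14-g23-0; B1 fold owner).  SKELETON rows served: **B1.Eq1.6** and **B1.Eq1.21** (r01's
rows; decls of record the typer's `HiggsLattice.curl`, `HiggsLattice.Params.vol`, r01's `B1Sect1Statements.volT`, all KEPT):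
each display prints TWO forms joined by `=`; the carrier definitions are the first resp. second form; this file proves the
other one, so that the displays are typed with BOTH bodies (READING RULE (a)/(b)).

WHAT IS PRINTED (verbatim).  p. 604 [PDF 2]: *"We define also the derivative for a function on bonds: (∂^εA)(P) =
ε^{−1} Σ_{b⊂∂P} A_b = (∂^ε_μ A_ν)(x) − (∂^ε_ν A_μ)(x), (1.6) where P is a plaquette, i.e. an elementary square of the
lattice, P = ⟨x, x + εe_μ, x + εe_μ + εe_ν, x + εe_ν⟩ for x ∈ T_ε, μ < ν."* (with p. 604: *"For a function g defined on
bonds we assume g_{−b} = −g_b. The difference derivative is defined by the formula (∂^εf)(b) = ε^{−1}(f(b₊) − f(b₋)). (1.4)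
… The difference derivative in a given direction μ can be defined in an obvious way also."* and *"A_{⟨x,x+εe_μ⟩} =
A_μ(x)"*).  p. 607 [PDF 5]: *"For the subsets Λ of the lattice ηZ^d a measure is defined by the formula |Λ| = Σ_{x∈Λ} η^d
= η^d (a number of points in Λ). (1.21)"*.

WHAT THIS FILE PROVES (theorems only; 0 `sorry`; standard axioms).
* `curl_eq_boundary_sum` — the first form of (1.6) is the typer's body (unfolding, for the record): `(∂^ηA)(P) =
  η⁻¹(A_{⟨x,μ⟩} + A_{⟨x+ηe_μ,ν⟩} − A_{⟨x+ηe_ν,μ⟩} − A_{⟨x,ν⟩})`, the boundary sum with the orientation `A_{−b} = −A_b`;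
* **`curl_eq_sderiv_sub`** — the SECOND form of (1.6): `(∂^ηA)(P) = (∂^η_μ A_ν)(x) − (∂^η_ν A_μ)(x)`, the directional
  difference derivatives being (1.4) on the bonds `⟨x, x+ηe_μ⟩`, `⟨x, x+ηe_ν⟩` of the components `A_ν = A.comp ν`,
  `A_μ = A.comp μ` (`HiggsLattice.sderiv`, `HiggsLattice.VecField.comp`);
* **`vol_eq_sum`** — the FIRST form of (1.21): `|Λ| = Σ_{x∈Λ} η^d` for the typer's `Params.vol` (whose body is the second
  form `η^d·(number of points in Λ)`, `vol_eq_mul_card`), and `volT_eq_sum` for r01's `|T_ε|` (`B1Sect1Statements.volT`).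
HONEST SCOPE.  Definitions with bodies exist already (typer p239040, r01 p239833); this file adds only the printed identities
between the two forms of each display; nothing quantitative.
-/

open scoped BigOperators

namespace Literature.MathematicalPhysics.QuantumFieldTheory.Balaban1983to89.B1Eq16Eq121PrintedForms

open HiggsLattice

variable {P : HiggsLattice.Params} {k : ℕ}

/-- (1.6), first form — the typer's body of `HiggsLattice.curl`, for the record: `(∂^ηA)(P) = η⁻¹ Σ_{b⊂∂P} A_b` with the
boundary of `P = ⟨x, x+ηe_μ, x+ηe_μ+ηe_ν, x+ηe_ν⟩` traversed `x → x+ηe_μ → x+ηe_μ+ηe_ν → x+ηe_ν → x` and `A_{−b} = −A_b`.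
[cite: Balaban1982Higgs1, (1.6) p.604] -/
theorem curl_eq_boundary_sum (A : HiggsLattice.VecField P k) (p : HiggsLattice.Plaq P k) :
    curl A p = (P.mesh k)⁻¹ *
      (A ⟨p.src, p.μ⟩ + A ⟨p.src.shift p.μ, p.ν⟩ - A ⟨p.src.shift p.ν, p.μ⟩ - A ⟨p.src, p.ν⟩) := rfl

/-- **(1.6), second form**, verbatim: *"(∂^εA)(P) = … = (∂^ε_μ A_ν)(x) − (∂^ε_ν A_μ)(x)"* — the plaquette derivative is
the lattice curl: the difference derivative (1.4) of the component `A_ν` along the bond `⟨x, x+ηe_μ⟩` minus that of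
`A_μ` along `⟨x, x+ηe_ν⟩`. PROVED (algebra). [cite: Balaban1982Higgs1, (1.6) p.604] -/
theorem curl_eq_sderiv_sub (A : HiggsLattice.VecField P k) (p : HiggsLattice.Plaq P k) :
    curl A p = sderiv (A.comp p.ν) ⟨p.src, p.μ⟩ - sderiv (A.comp p.μ) ⟨p.src, p.ν⟩ := by
  simp only [curl, sderiv, VecField.comp, PBond.tgt, smul_eq_mul]
  ring

/-- (1.21), second form — the typer's body of `HiggsLattice.Params.vol`, for the record: `|Λ| = η^d·(number of points
in Λ)`. [cite: Balaban1982Higgs1, (1.21) p.607] -/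
theorem vol_eq_mul_card (Λ : Finset (HiggsLattice.Site P k)) : P.vol k Λ = P.mesh k ^ P.d * (Λ.card : ℝ) := rfl

/-- **(1.21), first form**, verbatim: *"|Λ| = Σ_{x∈Λ} η^d"*. PROVED. [cite: Balaban1982Higgs1, (1.21) p.607] -/
theorem vol_eq_sum (Λ : Finset (HiggsLattice.Site P k)) : P.vol k Λ = ∑ _x ∈ Λ, P.mesh k ^ P.d := by
  rw [Finset.sum_const, nsmul_eq_mul, vol_eq_mul_card, mul_comm]

/-- (1.21) for the whole torus: `|T_ε| = Σ_{x∈T_ε} ε^d` (r01's `B1Sect1Statements.volT`). PROVED. [cite: Balaban1982Higgs1, (1.21) p.607] -/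
theorem volT_eq_sum (P : HiggsLattice.Params) :
    B1Sect1Statements.volT P = ∑ _x : HiggsLattice.Site P 0, P.mesh 0 ^ P.d := by
  rw [B1Sect1Statements.volT, vol_eq_sum]

end Literature.MathematicalPhysics.QuantumFieldTheory.Balaban1983to89.B1Eq16Eq121PrintedForms
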